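import Literature.AlgebraicGeometry.AbelianSchemes.PoincareSheafMulN
import Literature.AlgebraicGeometry.AbelianSchemes.AbelianSchemeDualIsogeny
import HarnessLib

/-!
# Additivity of the dual homomorphism: `(v₁ · v₂)^∨ = v₁^∨ · v₂^∨` ([MumfordAV1970] §15 Thm. 1; [MilneAV2008] I §9)

Topic `Literature/AlgebraicGeometry/AbelianSchemes`, namespace `Literature.AlgebraicGeometry.AbelianSchemes.AbelianSchemeOver(.DualPair)` (THEOREMS ONLY; no
definition, no named fact, no `sorry`, no `instance`, no notation; base `S` REDUCED and locally Noetherian — the standing hypotheses of ★ `PoincareSheafMulN`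
and ★ `PoincareSheafBiadditive`).  Cell `hodgecm-mathlib`, F0/P6 «MOD», organ **(D-add)** offered to LEAD F0P6-plan (g0) 16:17Z (the missing brick for an `𝒪`-action
`ι(a)^∨` on `Â`, i.e. for any dual pair ∕ polarisation ON the Serre tensor `A ⊗_𝒪 𝔟`); `--supports stmt-HodgeConjecture-24832`, count-neutral.  HC_CM is proved only
modulo the 2 remaining named inputs (hLiu418, h413) until rung 0 closes; this file discharges none of them.

## Mathematics

Let `v₁, v₂ : A′ → B` be homomorphisms of abelian schemes over `S` (so `v₁·v₂` is one), `D′ = (Â′, 𝒫′)`, `D_B = (B̂, 𝒫_B)` dual pairs.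
(§1) **`((v₁·v₂) × 1_{B̂})^*𝒫_B ≅ (v₁ × 1)^*𝒫_B ⊗ (v₂ × 1)^*𝒫_B`** on `A′ ×_S B̂` — biadditivity of `𝒫_B` in the FIRST variable: both sides are rigidified
fibrewise-`Pic⁰` families on `A′` parametrised by the REDUCED scheme `B̂` (★ `RigidifiedLineBundle.comapHom`, ★ `…Tensor`), with isomorphic geometric fibres by the
field theorem `(f·g)^*L ≅ f^*L ⊗ g^*L` for `L = 𝒫_{B,t} ∈ Pic⁰(B_s)` (★ `nonempty_pullback_hom_mul_iso_tensorObj`, [MumfordAV1970] §8 (iii)), so ★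
`nonempty_iso_of_forall_fibre_iso` applies — verbatim the road of ★ `nonempty_pullback_mulN_iso_tensorPow` (the case `v₁ = v₂ = …`, `[n]`).
(§2) **`dualIsogeny (v₁·v₂) = (v₁^∨ · v₂^∨)`**: by ★ `eq_dualIsogeny` it suffices that `(1 × v₁^∨v₂^∨)^*𝒫′ ≅ ((v₁v₂) × 1)^*𝒫_B`; the left side is
`(1 × v₁^∨)^*𝒫′ ⊗ (1 × v₂^∨)^*𝒫′` (★ `nonempty_pullbackP_mul_iso`, biadditivity in the second variable, unit hypothesis `hD′`) `≅ (v₁ × 1)^*𝒫_B ⊗ (v₂ × 1)^*𝒫_B`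
(★ (e1) `nonempty_pullbackP_dualIsogeny_iso`) `≅ ((v₁v₂) × 1)^*𝒫_B` (§1).

## Contents

* §1 `restrict_comapHom_P_iso` (plumbing: the geometric fibre of `(v × 1)^*𝒫_B` at `t` is `v_s^* 𝒫_{B,t}`), **`nonempty_pullback_baseChangeHom_mul_iso_tensorObj`**.
* §2 **`dualIsogeny_mul`**, **`dualIsogenyOver_mul`** (`dualIsogenyOver (v₁ * v₂) D′ DB = dualIsogenyOver v₁ D′ DB * dualIsogenyOver v₂ D′ DB`).

## References
* [MumfordAV1970] D. Mumford, *Abelian Varieties* (1970), §8 (iii)–(iv) (p. 75), §13 (p. 125), §15 Thm. 1 (p. 143).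
* [MilneAV2008] J. S. Milne, *Abelian Varieties* (2008), I §8 pp. 36–37, I §9 Thm. 9.1 (p. 42).
* Tree: ★ `PoincareSheafMulN`, ★ `PoincareSheafBiadditive`, ★ `RigidifiedPicZeroFamiliesOfReducedBase`, ★ `AbelianSchemeDualIsogeny`,
  ★ `AbelianVarieties/HomogeneousLineBundleMulPullback`, ★ `Modules/PullbackTensor`.
-/

noncomputable section

universe u

open CategoryTheory CategoryTheory.Limits AlgebraicGeometry MonoidalCategory CartesianMonoidalCategory
open scoped MonObj

-- `Scheme.Modules` / `SheafOfModules` are not reducible (as in ★ `PoincareSheafMulN`).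
set_option backward.isDefEq.respectTransparency false

namespace Literature.AlgebraicGeometry.AbelianSchemes

namespace AbelianSchemeOver

open Literature.AlgebraicGeometry.Motives Literature.AlgebraicGeometry.AbelianVarieties
  Literature.AlgebraicGeometry.Modules

variable {S : Scheme.{u}} {A' B : AbelianSchemeOver S} (DB : B.DualPair)

namespace DualPair

/-! ## §1 `𝒫_B` is multiplicative in the FIRST variable over a reduced base -/

/-- Plumbing: the fibre at a geometric point `t` of `B̂` of the family `(v × 1)^*𝒫_B` on `A′` is `v_s^*` of the fibre `𝒫_{B,t}` (`s = t ≫ π̂`).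
[cite: MilneAV2008, I §8 pp. 36–37] -/
theorem nonempty_restrict_pullback_baseChangeHom_iso (v : A'.X ⟶ B.X) {Ω : Type u} [Field Ω] (t : Spec (.of Ω) ⟶ DB.hat.X.left) :
    Nonempty ((Scheme.Modules.pullback (A'.restrictLeft DB.hat.X.hom t)).obj
        ((Scheme.Modules.pullback (baseChangeHom v DB.hat.X.hom).left).obj DB.P) ≅
      (Scheme.Modules.pullback (baseChangeHom v (t ≫ DB.hat.X.hom)).left).obj
        ((Scheme.Modules.pullback (B.restrictLeft DB.hat.X.hom t)).obj DB.P)) := by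
  have hsq := A'.restrictLeft_comp_baseChangeHom_left B DB.hat.X.hom t v
  exact ⟨(Scheme.Modules.pullbackComp _ _).app DB.P ≪≫ (Scheme.Modules.pullbackCongr hsq).app DB.P ≪≫
    ((Scheme.Modules.pullbackComp _ _).app DB.P).symm⟩

variable [IsReduced S] [IsLocallyNoetherian S]

/-- **`((v₁·v₂) × 1_{B̂})^*𝒫_B ≅ (v₁ × 1)^*𝒫_B ⊗ (v₂ × 1)^*𝒫_B` on `A′ ×_S B̂`** (biadditivity of the Poincaré sheaf in the first variable, `S` reduced and
locally Noetherian; needs a dual pair `D′` of `A′` for the fibrewise criterion). [cite: MumfordAV1970, §8 ((iii), p. 75) and §13 (p. 125)] [cite: MilneAV2008, I §8 pp. 36–37] -/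
theorem nonempty_pullback_baseChangeHom_mul_iso_tensorObj (D' : A'.DualPair) (v₁ v₂ : A'.X ⟶ B.X) [IsMonHom v₁] [IsMonHom v₂]
    [IsMonHom (v₁ * v₂)] :
    Nonempty ((Scheme.Modules.pullback (baseChangeHom (v₁ * v₂) DB.hat.X.hom).left).obj DB.P ≅
      tensorObj ((Scheme.Modules.pullback (baseChangeHom v₁ DB.hat.X.hom).left).obj DB.P)
        ((Scheme.Modules.pullback (baseChangeHom v₂ DB.hat.X.hom).left).obj DB.P)) := by
  haveI : IsReduced DB.hat.X.left := DB.hat.isReduced_left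
  -- the two families on `A′` parametrised by `B̂`
  let ℒa : A'.RigidifiedLineBundle DB.hat.X.hom := (selfBundle DB).comapHom v₁
  let ℒb : A'.RigidifiedLineBundle DB.hat.X.hom := (selfBundle DB).comapHom v₂
  let ℒ₂ : A'.RigidifiedLineBundle DB.hat.X.hom :=
    ⟨tensorObj ℒa.L ℒb.L, RigidifiedLineBundle.hasRank_one_tensorObj ℒa ℒb, RigidifiedLineBundle.rigid_tensorObj ℒa ℒb⟩
  have ha : ℒa.FibrewisePicZero := (selfBundle_fibrewisePicZero DB).comapHom v₁
  have hb : ℒb.FibrewisePicZero := (selfBundle_fibrewisePicZero DB).comapHom v₂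
  have h₂ : ℒ₂.FibrewisePicZero := RigidifiedLineBundle.fibrewisePicZero_tensorObj ℒa ℒb ha hb
  exact nonempty_iso_of_forall_fibre_iso D' ((selfBundle DB).comapHom (v₁ * v₂)) ℒ₂
    ((selfBundle_fibrewisePicZero DB).comapHom (v₁ * v₂)) h₂ fun Ω _ _ t => by
    -- the fibre at `t`: `(v₁v₂)_s^* 𝒫_t ≅ v₁_s^*𝒫_t ⊗ v₂_s^*𝒫_t` on `A′_s`, `𝒫_t ∈ Pic⁰(B_s)`
    have hr : HasRank ((Scheme.Modules.pullback (B.restrictLeft DB.hat.X.hom t)).obj DB.P) 1 := hasRank_pullback _ DB.hasRank_one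
    obtain ⟨e⟩ := nonempty_pullback_hom_mul_iso_tensorObj (B.fibre (t ≫ DB.hat.X.hom)).toAbelianVariety hr
      (HasRank.isFiniteLocallyFree' hr) (DB.isHomogeneous_pullback_restrictLeft t)
      (Y := (A'.fibre (t ≫ DB.hat.X.hom)).toAbelianVariety.X)
      (baseChangeHom v₁ (t ≫ DB.hat.X.hom)) (baseChangeHom v₂ (t ≫ DB.hat.X.hom))
    have hmul : ((baseChangeHom v₁ (t ≫ DB.hat.X.hom) : (A'.fibre (t ≫ DB.hat.X.hom)).toAbelianVariety.X ⟶
        (B.fibre (t ≫ DB.hat.X.hom)).toAbelianVariety.X) * baseChangeHom v₂ (t ≫ DB.hat.X.hom)).left =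
        (baseChangeHom (v₁ * v₂) (t ≫ DB.hat.X.hom)).left := by
      rw [A'.baseChangeHom_mul B (t ≫ DB.hat.X.hom) v₁ v₂]
    obtain ⟨i₁₂⟩ := nonempty_restrict_pullback_baseChangeHom_iso DB (v₁ * v₂) t
    obtain ⟨i₁⟩ := nonempty_restrict_pullback_baseChangeHom_iso DB v₁ t
    obtain ⟨i₂⟩ := nonempty_restrict_pullback_baseChangeHom_iso DB v₂ t
    have hfa : IsFiniteLocallyFree ℒa.L := HasRank.isFiniteLocallyFree' ℒa.hasRank_one
    have hfb : IsFiniteLocallyFree ℒb.L := HasRank.isFiniteLocallyFree' ℒb.hasRank_one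
    rw [RigidifiedLineBundle.comapHom_L, selfBundle_L]
    refine ⟨i₁₂ ≪≫ (Scheme.Modules.pullbackCongr hmul.symm).app _ ≪≫ e ≪≫ (tensorMapIso i₁ i₂).symm ≪≫
      (pullbackTensorIso (A'.restrictLeft DB.hat.X.hom t) hfa hfb).symm⟩

/-! ## §2 `(v₁ · v₂)^∨ = v₁^∨ · v₂^∨` -/

/-- **`dualIsogeny (v₁·v₂) = (v₁^∨ · v₂^∨)`** as morphisms of schemes `B̂ → Â′` (product in `Hom_S(B̂, Â′)`), for `S` reduced and locally Noetherian and the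
unit hypothesis `hD′` on `D′`. [cite: MumfordAV1970, §15 Thm. 1 (p. 143)] [cite: MilneAV2008, I §9 Thm. 9.1 (p. 42)] -/
theorem dualIsogeny_mul (D' : A'.DualPair)
    (hD' : Nonempty ((Scheme.Modules.pullback (unitHatSlice D')).obj D'.P ≅ SheafOfModules.unit _))
    (v₁ v₂ : A'.X ⟶ B.X) [IsMonHom v₁] [IsMonHom v₂] [IsMonHom (v₁ * v₂)] :
    dualIsogeny (v₁ * v₂) D' DB =
      ((dualIsogenyOver v₁ D' DB : Over.mk DB.hat.X.hom ⟶ D'.hat.X) * dualIsogenyOver v₂ D' DB).left := by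
  symm
  refine eq_dualIsogeny (v₁ * v₂) D' DB _ (Over.w _) ?_
  obtain ⟨m⟩ := D'.nonempty_pullbackP_mul_iso hD' DB.hat.X.hom (dualIsogenyOver v₁ D' DB) (dualIsogenyOver v₂ D' DB)
  obtain ⟨e₁⟩ := nonempty_pullbackP_dualIsogeny_iso v₁ D' DB
  obtain ⟨e₂⟩ := nonempty_pullbackP_dualIsogeny_iso v₂ D' DB
  obtain ⟨e⟩ := nonempty_pullback_baseChangeHom_mul_iso_tensorObj DB D' v₁ v₂
  exact ⟨m ≪≫ tensorMapIso e₁ e₂ ≪≫ e.symm⟩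

/-- **`(v₁ · v₂)^∨ = v₁^∨ · v₂^∨` in `Over S`**: `f ↦ f^∨` is a homomorphism `Hom(A′, B) → Hom(B̂, Â′)`. [cite: MumfordAV1970, §15 Thm. 1 (p. 143)]
[cite: MilneAV2008, I §9 Thm. 9.1 (p. 42)] -/
theorem dualIsogenyOver_mul (D' : A'.DualPair)
    (hD' : Nonempty ((Scheme.Modules.pullback (unitHatSlice D')).obj D'.P ≅ SheafOfModules.unit _))
    (v₁ v₂ : A'.X ⟶ B.X) [IsMonHom v₁] [IsMonHom v₂] [IsMonHom (v₁ * v₂)] :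
    dualIsogenyOver (v₁ * v₂) D' DB = dualIsogenyOver v₁ D' DB * dualIsogenyOver v₂ D' DB :=
  Over.OverMorphism.ext (dualIsogeny_mul DB D' hD' v₁ v₂)

end DualPair

end AbelianSchemeOver

end Literature.AlgebraicGeometry.AbelianSchemes

end
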